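import Mathlib
import Summits.FinalStateConjecture.FinalStateConjecture.Theorems.EIHFluxBalanceModulatedKerrHandoffDragDefectTaylor
import Summits.FinalStateConjecture.FinalStateConjecture.Theorems.EIHFluxBalanceInertialRecessionCalculus
import Literature.Geometry.Lorentzian.CoordCurvaturePointwise

/-!
# Route EIHFluxBalance — `ModulatedKerrHandoff`, stub `stub_dragDefect`: the jets of the drag error

Helper file for the crux `stmt-FinalStateConjecture-10167`
(`Summit.FinalStateConjecture.FinalStateConjecture.Theses.EIHFluxBalance.ModulatedKerrHandoff`),
line `overlap-modulation-second-iterate`, stub `stub_dragDefect`.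

For a field of bilinear forms `h` on `E4`, smooth on a ball `B = B(x, r)`, and a linear drag
`A : E4 →L E4` with `x + Ax ∈ B`, `‖A‖ ≤ 1`, the DRAG ERROR
`E(y) = h(y) + Dh(y)[Ay] + h(y)(A·,·) + h(y)(·,A·) − ((1+A)^*h)(y)`,
`((1+A)^*h)(y) = h(y + Ay)((1+A)·,(1+A)·)`, has scalar components made of the Taylor remainders of
`…DragDefectTaylor(Second)` (`dragError_apply_eq`), hence jets at `x` that are QUADRATIC IN `A`:
with `Nₖ ≥ sup_B ‖Dᵏh‖` (`k ≤ 4`), `a = ‖A‖`, `b = ‖Ax‖`,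

* `‖E(x)‖ ≤ N₂ b² + 2 N₁ a b + N₀ a²`, `‖D¹E(x)‖ ≤ N₃ b² + 3 N₂ a b + 4 N₁ a²`,
  `‖D²E(x)‖ ≤ N₄ b² + 4 N₃ a b + 11 N₂ a²` (`norm_iteratedFDeriv_dragError_le`),

and the pulled-back field has `‖Dʲ((1+A)^*h)(x)‖ ≤ 4·2ʲ Nⱼ` (`norm_iteratedFDeriv_pullback_le`).
The operator norm of `Dʲ` of a form-valued map is recovered from its scalar components
(`norm_iteratedFDeriv_le_of_forall_apply₂`, `…InertialRecessionCalculus`), which keeps all iterated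
`fderiv`s scalar-valued.
-/

noncomputable section

-- `Summit.<S>.<S>.…` (single-problem summit, D-0017) trips core's duplicate-namespace linter.
set_option linter.dupNamespace false
set_option maxSynthPendingDepth 3

open Set Function Filter Metric ContinuousLinearMap Literature.Geometry.Lorentzian
open scoped Topology ContDiff

namespace Summit.FinalStateConjecture.FinalStateConjecture.Theorems

namespace DragDefect

/-! ### Scalar components of a smooth form field on a ball -/

section Scalar

variable {h : E4 → E4 →L[ℝ] E4 →L[ℝ] ℝ} {x : E4} {r : ℝ}

/-- `‖D(D(Df))(y)‖ = ‖D³f(y)‖` for a scalar function. [folklore] -/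
theorem norm_fderiv₃_eq (f : E4 → ℝ) (y : E4) :
    ‖fderiv ℝ (fderiv ℝ (fderiv ℝ f)) y‖ = ‖iteratedFDeriv ℝ 3 f y‖ := by
  rw [← norm_iteratedFDeriv_zero (𝕜 := ℝ) (f := fderiv ℝ (fderiv ℝ (fderiv ℝ f))),
    norm_iteratedFDeriv_fderiv, norm_iteratedFDeriv_fderiv, norm_iteratedFDeriv_fderiv]

/-- `‖D(D(D(Df)))(y)‖ = ‖D⁴f(y)‖` for a scalar function. [folklore] -/
theorem norm_fderiv₄_eq (f : E4 → ℝ) (y : E4) :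
    ‖fderiv ℝ (fderiv ℝ (fderiv ℝ (fderiv ℝ f))) y‖ = ‖iteratedFDeriv ℝ 4 f y‖ := by
  rw [← norm_iteratedFDeriv_zero (𝕜 := ℝ) (f := fderiv ℝ (fderiv ℝ (fderiv ℝ (fderiv ℝ f)))),
    norm_iteratedFDeriv_fderiv, norm_iteratedFDeriv_fderiv, norm_iteratedFDeriv_fderiv,
    norm_iteratedFDeriv_fderiv]

/-- The scalar components `z ↦ h(z)(v, w)` are `C^∞` on the ball. [folklore] -/
theorem contDiffOn_apply₂ (hh : ContDiffOn ℝ ∞ h (ball x r)) (v w : E4) :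
    ContDiffOn ℝ ∞ (fun z ↦ h z v w) (ball x r) :=
  (hh.clm_apply contDiffOn_const).clm_apply contDiffOn_const

/-- **Jets of the scalar components**: `‖Dᵐ(z ↦ h(z)(v,w))(z)‖ ≤ ‖v‖ ‖w‖ ‖Dᵐh(z)‖` on the ball.
[folklore] -/
theorem norm_iteratedFDeriv_apply₂_le (hh : ContDiffOn ℝ ∞ h (ball x r)) {z : E4}
    (hz : z ∈ ball x r) (v w : E4) (m : ℕ) :
    ‖iteratedFDeriv ℝ m (fun z ↦ h z v w) z‖ ≤ ‖v‖ * ‖w‖ * ‖iteratedFDeriv ℝ m h z‖ := by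
  have hhz : ContDiffAt ℝ ∞ h z := (hh z hz).contDiffAt (isOpen_ball.mem_nhds hz)
  have h1 : ContDiffAt ℝ ∞ (fun z ↦ h z v) z := hhz.clm_apply contDiffAt_const
  have e1 := norm_iteratedFDeriv_clm_apply_const (f := fun z ↦ h z v) (c := w) (x := z) (n := m) h1
    (by exact_mod_cast le_top)
  have e2 := norm_iteratedFDeriv_clm_apply_const (f := h) (c := v) (x := z) (n := m) hhz
    (by exact_mod_cast le_top)
  calc _ ≤ ‖w‖ * ‖iteratedFDeriv ℝ m (fun z ↦ h z v) z‖ := e1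
    _ ≤ ‖w‖ * (‖v‖ * ‖iteratedFDeriv ℝ m h z‖) := by gcongr
    _ = _ := by ring

/-- The four nested-`fderiv` sup bounds of a scalar component on the ball, from bounds `Nₖ` on
`‖Dᵏh‖`. [folklore] -/
theorem scalar_sup_bounds (hh : ContDiffOn ℝ ∞ h (ball x r)) {N₁ N₂ N₃ N₄ : ℝ}
    (h1 : ∀ z ∈ ball x r, ‖iteratedFDeriv ℝ 1 h z‖ ≤ N₁)
    (h2 : ∀ z ∈ ball x r, ‖iteratedFDeriv ℝ 2 h z‖ ≤ N₂)
    (h3 : ∀ z ∈ ball x r, ‖iteratedFDeriv ℝ 3 h z‖ ≤ N₃)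
    (h4 : ∀ z ∈ ball x r, ‖iteratedFDeriv ℝ 4 h z‖ ≤ N₄) (v w : E4) :
    (∀ z ∈ ball x r, ‖fderiv ℝ (fun z ↦ h z v w) z‖ ≤ N₁ * ‖v‖ * ‖w‖) ∧
    (∀ z ∈ ball x r, ‖fderiv ℝ (fderiv ℝ (fun z ↦ h z v w)) z‖ ≤ N₂ * ‖v‖ * ‖w‖) ∧
    (∀ z ∈ ball x r, ‖fderiv ℝ (fderiv ℝ (fderiv ℝ (fun z ↦ h z v w))) z‖ ≤ N₃ * ‖v‖ * ‖w‖) ∧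
    (∀ z ∈ ball x r,
      ‖fderiv ℝ (fderiv ℝ (fderiv ℝ (fderiv ℝ (fun z ↦ h z v w)))) z‖ ≤ N₄ * ‖v‖ * ‖w‖) := by
  have key : ∀ (m : ℕ) {N : ℝ}, (∀ z ∈ ball x r, ‖iteratedFDeriv ℝ m h z‖ ≤ N) →
      ∀ z ∈ ball x r, ‖iteratedFDeriv ℝ m (fun z ↦ h z v w) z‖ ≤ N * ‖v‖ * ‖w‖ := by
    intro m N hN z hz
    calc _ ≤ ‖v‖ * ‖w‖ * ‖iteratedFDeriv ℝ m h z‖ := norm_iteratedFDeriv_apply₂_le hh hz v w m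
      _ ≤ ‖v‖ * ‖w‖ * N := by gcongr; exact hN z hz
      _ = _ := by ring
  refine ⟨fun z hz ↦ ?_, fun z hz ↦ ?_, fun z hz ↦ ?_, fun z hz ↦ ?_⟩
  · rw [← norm_iteratedFDeriv_one]; exact key 1 h1 z hz
  · rw [← norm_iteratedFDeriv_zero (𝕜 := ℝ) (f := fderiv ℝ (fderiv ℝ fun z ↦ h z v w)),
      norm_iteratedFDeriv_fderiv, norm_iteratedFDeriv_fderiv]
    exact key 2 h2 z hz
  · rw [norm_fderiv₃_eq]; exact key 3 h3 z hz
  · rw [norm_fderiv₄_eq]; exact key 4 h4 z hz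

end Scalar

/-! ### The drag error and its scalar components -/

section DragError

variable {h : E4 → E4 →L[ℝ] E4 →L[ℝ] ℝ} {A : E4 →L[ℝ] E4} {x : E4} {r : ℝ}

/-- **Scalar components of the drag error**: with `ψ_{v,w}(z) = h(z)(v, w)`,
`E(y)(v,w) = −[ψ_{v,w}(y+Ay) − ψ_{v,w}(y) − Dh(y)(Ay)(v,w)] − [ψ_{Av,w}(y+Ay) − ψ_{Av,w}(y)]
 − [ψ_{v,Aw}(y+Ay) − ψ_{v,Aw}(y)] − ψ_{Av,Aw}(y+Ay)` (pure algebra). [folklore] -/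
theorem dragError_apply_eq (h : E4 → E4 →L[ℝ] E4 →L[ℝ] ℝ) (A : E4 →L[ℝ] E4) (y v w : E4) :
    (h y + fderiv ℝ h y (A y) + (h y).comp A + (ContinuousLinearMap.precomp ℝ A).comp (h y)
        - (h (y + A y)).bilinearComp (ContinuousLinearMap.id ℝ E4 + A)
            (ContinuousLinearMap.id ℝ E4 + A)) v w =
      -(h (y + A y) v w - h y v w - fderiv ℝ h y (A y) v w)
        - (h (y + A y) (A v) w - h y (A v) w) - (h (y + A y) v (A w) - h y v (A w))
        - h (y + A y) (A v) (A w) := by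
  simp only [bilinearComp_apply, _root_.add_apply, _root_.sub_apply, id_apply, map_add,
    ContinuousLinearMap.comp_apply, ContinuousLinearMap.precomp_apply]
  ring

/-- Near a point of differentiability of `h`, the scalar components of the drag error are the
Taylor remainders of the scalar components of `h`. [folklore] -/
theorem dragError_apply_eventuallyEq (hh : ContDiffOn ℝ ∞ h (ball x r)) (hx : x ∈ ball x r)
    (v w : E4) :
    (fun y ↦ (h y + fderiv ℝ h y (A y) + (h y).comp A
        + (ContinuousLinearMap.precomp ℝ A).comp (h y)
        - (h (y + A y)).bilinearComp (ContinuousLinearMap.id ℝ E4 + A)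
            (ContinuousLinearMap.id ℝ E4 + A)) v w) =ᶠ[𝓝 x]
      fun y ↦ -((fun z ↦ h z v w) (y + A y) - (fun z ↦ h z v w) y
          - fderiv ℝ (fun z ↦ h z v w) y (A y))
        - ((fun z ↦ h z (A v) w) (y + A y) - (fun z ↦ h z (A v) w) y)
        - ((fun z ↦ h z v (A w)) (y + A y) - (fun z ↦ h z v (A w)) y)
        - (fun z ↦ h z (A v) (A w)) (y + A y) := by
  filter_upwards [isOpen_ball.mem_nhds hx] with y hy
  have hd : DifferentiableAt ℝ h y :=
    ((hh y hy).contDiffAt (isOpen_ball.mem_nhds hy)).differentiableAt (by simp)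
  rw [dragError_apply_eq, ← MetricCoord.fderiv_apply₂_of_differentiableAt hd v w (A y)]

/-- The drag error is `C^∞` at `x`. [folklore] -/
theorem contDiffAt_dragError (hh : ContDiffOn ℝ ∞ h (ball x r)) (hx : x ∈ ball x r)
    (hAx : x + A x ∈ ball x r) :
    ContDiffAt ℝ ∞ (fun y ↦ h y + fderiv ℝ h y (A y) + (h y).comp A
        + (ContinuousLinearMap.precomp ℝ A).comp (h y)
        - (h (y + A y)).bilinearComp (ContinuousLinearMap.id ℝ E4 + A)
            (ContinuousLinearMap.id ℝ E4 + A)) x := by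
  have hhx : ContDiffAt ℝ ∞ h x := (hh x hx).contDiffAt (isOpen_ball.mem_nhds hx)
  have hA : ContDiffAt ℝ ∞ (fun y : E4 ↦ A y) x := A.contDiff.contDiffAt
  have haff : ContDiffAt ℝ ∞ (fun y : E4 ↦ y + A y) x := contDiffAt_id.add hA
  have hD : ContDiffAt ℝ ∞ (fderiv ℝ h) x :=
    ((hh.fderiv_of_isOpen isOpen_ball (by simp)) x hx).contDiffAt (isOpen_ball.mem_nhds hx)
  have h1 : ContDiffAt ℝ ∞ (fun y ↦ fderiv ℝ h y (A y)) x := hD.clm_apply hA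
  have h2 : ContDiffAt ℝ ∞ (fun y ↦ (h y).comp A) x := hhx.clm_comp contDiffAt_const
  have h3 : ContDiffAt ℝ ∞ (fun y ↦ (ContinuousLinearMap.precomp ℝ A).comp (h y)) x :=
    contDiffAt_const.clm_comp hhx
  have hcomp : ContDiffAt ℝ ∞ (fun y ↦ h (y + A y)) x :=
    ((hh _ hAx).contDiffAt (isOpen_ball.mem_nhds hAx)).comp x haff
  -- the pull-back as iterated compositions of continuous linear maps
  have h4 : ContDiffAt ℝ ∞ (fun y ↦ (h (y + A y)).bilinearComp (ContinuousLinearMap.id ℝ E4 + A)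
      (ContinuousLinearMap.id ℝ E4 + A)) x := by
    have e : (fun y ↦ (h (y + A y)).bilinearComp (ContinuousLinearMap.id ℝ E4 + A)
        (ContinuousLinearMap.id ℝ E4 + A)) = fun y ↦
        (ContinuousLinearMap.precomp ℝ (ContinuousLinearMap.id ℝ E4 + A)).comp
          ((h (y + A y)).comp (ContinuousLinearMap.id ℝ E4 + A)) := by
      funext y; ext v w; rfl
    rw [e]
    exact contDiffAt_const.clm_comp (hcomp.clm_comp contDiffAt_const)
  exact (((hhx.add h1).add h2).add h3).sub h4

/-- The scalar pieces are `C^∞` at `x`: the composite. [folklore] -/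
theorem contDiffAt_scalar_comp (hh : ContDiffOn ℝ ∞ h (ball x r)) (hAx : x + A x ∈ ball x r)
    (v w : E4) : ContDiffAt ℝ ∞ (fun y ↦ (fun z ↦ h z v w) (y + A y)) x := by
  have hψ := contDiffOn_apply₂ hh v w
  exact ((hψ _ hAx).contDiffAt (isOpen_ball.mem_nhds hAx)).comp x
    (contDiffAt_id.add A.contDiff.contDiffAt)

/-- The scalar pieces are `C^∞` at `x`: the first-order remainder. [folklore] -/
theorem contDiffAt_scalar_delta (hh : ContDiffOn ℝ ∞ h (ball x r)) (hx : x ∈ ball x r)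
    (hAx : x + A x ∈ ball x r) (v w : E4) :
    ContDiffAt ℝ ∞ (fun y ↦ (fun z ↦ h z v w) (y + A y) - (fun z ↦ h z v w) y) x :=
  (contDiffAt_scalar_comp hh hAx v w).sub
    (((contDiffOn_apply₂ hh v w) x hx).contDiffAt (isOpen_ball.mem_nhds hx))

/-- The scalar pieces are `C^∞` at `x`: the second-order remainder. [folklore] -/
theorem contDiffAt_scalar_rem (hh : ContDiffOn ℝ ∞ h (ball x r)) (hx : x ∈ ball x r)
    (hAx : x + A x ∈ ball x r) (v w : E4) :
    ContDiffAt ℝ ∞ (fun y ↦ (fun z ↦ h z v w) (y + A y) - (fun z ↦ h z v w) y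
      - fderiv ℝ (fun z ↦ h z v w) y (A y)) x := by
  have hψ := contDiffOn_apply₂ hh v w
  have hD : ContDiffAt ℝ ∞ (fderiv ℝ (fun z ↦ h z v w)) x :=
    ((hψ.fderiv_of_isOpen isOpen_ball (by simp)) x hx).contDiffAt (isOpen_ball.mem_nhds hx)
  exact (contDiffAt_scalar_delta hh hx hAx v w).sub (hD.clm_apply A.contDiff.contDiffAt)

end DragError

/-! ### The jets of the drag error at `x` -/

section Bounds

variable {h : E4 → E4 →L[ℝ] E4 →L[ℝ] ℝ} {A : E4 →L[ℝ] E4} {x : E4} {r N₀ N₁ N₂ N₃ N₄ : ℝ}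

/-- **Zeroth jet of the components of the drag error**:
`|E(x)(v,w)| ≤ (N₂ ‖Ax‖² + 2 N₁ ‖A‖ ‖Ax‖ + N₀ ‖A‖²) ‖v‖ ‖w‖`. [folklore] -/
theorem abs_dragError_apply_le (hh : ContDiffOn ℝ ∞ h (ball x r)) (hx : x ∈ ball x r)
    (hAx : x + A x ∈ ball x r) (h0 : ∀ z ∈ ball x r, ‖h z‖ ≤ N₀)
    (h1 : ∀ z ∈ ball x r, ‖iteratedFDeriv ℝ 1 h z‖ ≤ N₁)
    (h2 : ∀ z ∈ ball x r, ‖iteratedFDeriv ℝ 2 h z‖ ≤ N₂)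
    (h3 : ∀ z ∈ ball x r, ‖iteratedFDeriv ℝ 3 h z‖ ≤ N₃)
    (h4 : ∀ z ∈ ball x r, ‖iteratedFDeriv ℝ 4 h z‖ ≤ N₄) (v w : E4) :
    ‖(h x + fderiv ℝ h x (A x) + (h x).comp A + (ContinuousLinearMap.precomp ℝ A).comp (h x)
        - (h (x + A x)).bilinearComp (ContinuousLinearMap.id ℝ E4 + A)
            (ContinuousLinearMap.id ℝ E4 + A)) v w‖ ≤
      (N₂ * ‖A x‖ ^ 2 + 2 * N₁ * ‖A‖ * ‖A x‖ + N₀ * ‖A‖ ^ 2) * ‖v‖ * ‖w‖ := by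
  have hd : DifferentiableAt ℝ h x :=
    ((hh x hx).contDiffAt (isOpen_ball.mem_nhds hx)).differentiableAt (by simp)
  rw [dragError_apply_eq, ← MetricCoord.fderiv_apply₂_of_differentiableAt hd v w (A x)]
  have hN₁ : 0 ≤ N₁ := (norm_nonneg _).trans (h1 x hx)
  -- the four scalar pieces
  obtain ⟨b1, b2, -, -⟩ := scalar_sup_bounds hh h1 h2 h3 h4 v w
  obtain ⟨c1, -, -, -⟩ := scalar_sup_bounds hh h1 h2 h3 h4 (A v) w
  obtain ⟨d1, -, -, -⟩ := scalar_sup_bounds hh h1 h2 h3 h4 v (A w)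
  have hψ := contDiffOn_apply₂ hh v w
  have t1 := norm_rem_le (A := A) isOpen_ball (convex_ball x r) hψ hx hAx b2
  have t2 := norm_delta_le (A := A) isOpen_ball (convex_ball x r) (contDiffOn_apply₂ hh (A v) w)
    hx hAx c1
  have t3 := norm_delta_le (A := A) isOpen_ball (convex_ball x r) (contDiffOn_apply₂ hh v (A w))
    hx hAx d1
  have hN₀ : 0 ≤ N₀ := (norm_nonneg _).trans (h0 x hx)
  have hAv : ‖A v‖ ≤ ‖A‖ * ‖v‖ := le_opNorm _ _
  have hAw : ‖A w‖ ≤ ‖A‖ * ‖w‖ := le_opNorm _ _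
  have t4 : ‖h (x + A x) (A v) (A w)‖ ≤ N₀ * (‖A‖ * ‖v‖) * (‖A‖ * ‖w‖) :=
    (le_opNorm₂ _ _ _).trans (mul_le_mul (mul_le_mul (h0 _ hAx) hAv (norm_nonneg _) hN₀) hAw
      (norm_nonneg _) (by positivity))
  have t2' : N₁ * ‖A v‖ * ‖w‖ * ‖A x‖ ≤ N₁ * (‖A‖ * ‖v‖) * ‖w‖ * ‖A x‖ := by gcongr
  have t3' : N₁ * ‖v‖ * ‖A w‖ * ‖A x‖ ≤ N₁ * ‖v‖ * (‖A‖ * ‖w‖) * ‖A x‖ := by gcongr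
  calc _ ≤ N₂ * ‖v‖ * ‖w‖ * ‖A x‖ ^ 2 + N₁ * ‖A v‖ * ‖w‖ * ‖A x‖ + N₁ * ‖v‖ * ‖A w‖ * ‖A x‖
        + N₀ * (‖A‖ * ‖v‖) * (‖A‖ * ‖w‖) := by
          refine norm_sub_le_of_le (norm_sub_le_of_le (norm_sub_le_of_le ?_ t2) t3) t4
          rw [norm_neg]; exact t1
    _ ≤ N₂ * ‖v‖ * ‖w‖ * ‖A x‖ ^ 2 + N₁ * (‖A‖ * ‖v‖) * ‖w‖ * ‖A x‖
        + N₁ * ‖v‖ * (‖A‖ * ‖w‖) * ‖A x‖ + N₀ * (‖A‖ * ‖v‖) * (‖A‖ * ‖w‖) := by linarith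
    _ = _ := by ring

/-- **First jet of the components of the drag error**:
`‖D(E(·)(v,w))(x)‖ ≤ (N₃ ‖Ax‖² + 3 N₂ ‖A‖ ‖Ax‖ + 4 N₁ ‖A‖²) ‖v‖ ‖w‖` (`‖A‖ ≤ 1`). [folklore] -/
theorem norm_fderiv_dragError_apply_le (hh : ContDiffOn ℝ ∞ h (ball x r)) (hx : x ∈ ball x r)
    (hAx : x + A x ∈ ball x r) (hA : ‖A‖ ≤ 1)
    (h1 : ∀ z ∈ ball x r, ‖iteratedFDeriv ℝ 1 h z‖ ≤ N₁)
    (h2 : ∀ z ∈ ball x r, ‖iteratedFDeriv ℝ 2 h z‖ ≤ N₂)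
    (h3 : ∀ z ∈ ball x r, ‖iteratedFDeriv ℝ 3 h z‖ ≤ N₃)
    (h4 : ∀ z ∈ ball x r, ‖iteratedFDeriv ℝ 4 h z‖ ≤ N₄) (v w : E4) :
    ‖iteratedFDeriv ℝ 1 (fun y ↦ (h y + fderiv ℝ h y (A y) + (h y).comp A
        + (ContinuousLinearMap.precomp ℝ A).comp (h y)
        - (h (y + A y)).bilinearComp (ContinuousLinearMap.id ℝ E4 + A)
            (ContinuousLinearMap.id ℝ E4 + A)) v w) x‖ ≤
      (N₃ * ‖A x‖ ^ 2 + 3 * N₂ * ‖A‖ * ‖A x‖ + 4 * N₁ * ‖A‖ ^ 2) * ‖v‖ * ‖w‖ := by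
  rw [norm_iteratedFDeriv_one, ((dragError_apply_eventuallyEq hh hx v w).fderiv_eq)]
  have hN₁ : 0 ≤ N₁ := (norm_nonneg _).trans (h1 x hx)
  have hN₂ : 0 ≤ N₂ := (norm_nonneg _).trans (h2 x hx)
  have ha : 0 ≤ ‖A‖ := norm_nonneg _
  obtain ⟨-, b2, b3, -⟩ := scalar_sup_bounds hh h1 h2 h3 h4 v w
  obtain ⟨c1, c2, -, -⟩ := scalar_sup_bounds hh h1 h2 h3 h4 (A v) w
  obtain ⟨d1, d2, -, -⟩ := scalar_sup_bounds hh h1 h2 h3 h4 v (A w)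
  obtain ⟨e1, -, -, -⟩ := scalar_sup_bounds hh h1 h2 h3 h4 (A v) (A w)
  have hU : IsOpen (ball x r) := isOpen_ball
  have hC : Convex ℝ (ball x r) := convex_ball x r
  -- derivatives of the four pieces
  have dS := hasFDerivAt_rem hU (contDiffOn_apply₂ hh v w) hx hAx (A := A)
  have dΔ₁ := hasFDerivAt_delta hU (contDiffOn_apply₂ hh (A v) w) hx hAx (A := A)
  have dΔ₂ := hasFDerivAt_delta hU (contDiffOn_apply₂ hh v (A w)) hx hAx (A := A)
  have dC := hasFDerivAt_comp_affine hU (contDiffOn_apply₂ hh (A v) (A w)) hAx (A := A)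
  have hT : HasFDerivAt (fun y ↦ -((fun z ↦ h z v w) (y + A y) - (fun z ↦ h z v w) y
          - fderiv ℝ (fun z ↦ h z v w) y (A y))
        - ((fun z ↦ h z (A v) w) (y + A y) - (fun z ↦ h z (A v) w) y)
        - ((fun z ↦ h z v (A w)) (y + A y) - (fun z ↦ h z v (A w)) y)
        - (fun z ↦ h z (A v) (A w)) (y + A y)) _ x :=
    ((dS.neg.sub dΔ₁).sub dΔ₂).sub dC
  rw [hT.fderiv]
  -- their norms
  have nS := norm_fderiv_rem_le hU hC (contDiffOn_apply₂ hh v w) hx hAx b2 b3 (A := A)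
  have nΔ₁ := norm_fderiv_delta_le hU hC (contDiffOn_apply₂ hh (A v) w) hx hAx c1 c2 (A := A)
  have nΔ₂ := norm_fderiv_delta_le hU hC (contDiffOn_apply₂ hh v (A w)) hx hAx d1 d2 (A := A)
  have nC := norm_fderiv_comp_affine_le hU (contDiffOn_apply₂ hh (A v) (A w)) hAx e1 (A := A)
  rw [dS.fderiv] at nS
  rw [dΔ₁.fderiv] at nΔ₁
  rw [dΔ₂.fderiv] at nΔ₂
  rw [dC.fderiv] at nC
  have hAv : ‖A v‖ ≤ ‖A‖ * ‖v‖ := le_opNorm _ _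
  have hAw : ‖A w‖ ≤ ‖A‖ * ‖w‖ := le_opNorm _ _
  have hsum := norm_sub_le_of_le (norm_sub_le_of_le (norm_sub_le_of_le
    ((norm_neg _).le.trans nS) nΔ₁) nΔ₂) nC
  refine hsum.trans ?_
  have e₁ : N₂ * ‖A v‖ * ‖w‖ * ‖A x‖ + N₁ * ‖A v‖ * ‖w‖ * ‖A‖ ≤
      N₂ * (‖A‖ * ‖v‖) * ‖w‖ * ‖A x‖ + N₁ * (‖A‖ * ‖v‖) * ‖w‖ * ‖A‖ := by gcongr
  have e₂ : N₂ * ‖v‖ * ‖A w‖ * ‖A x‖ + N₁ * ‖v‖ * ‖A w‖ * ‖A‖ ≤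
      N₂ * ‖v‖ * (‖A‖ * ‖w‖) * ‖A x‖ + N₁ * ‖v‖ * (‖A‖ * ‖w‖) * ‖A‖ := by gcongr
  have e₃ : N₁ * ‖A v‖ * ‖A w‖ * (1 + ‖A‖) ≤ N₁ * (‖A‖ * ‖v‖) * (‖A‖ * ‖w‖) * 2 := by
    gcongr; linarith
  nlinarith [e₁, e₂, e₃, norm_nonneg v, norm_nonneg w, norm_nonneg (A x),
    mul_nonneg (mul_nonneg hN₁ ha) (mul_nonneg (norm_nonneg v) (norm_nonneg w))]

/-- **Registered sub-goal form** (stub `dragDefect_dragError_first_jet` of the crux item) of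
`norm_fderiv_dragError_apply_le`. [folklore] -/
theorem dragDefect_dragError_first_jet : open Literature.Geometry.Lorentzian Metric in ∀ {h : E4 → E4 →L[ℝ] E4 →L[ℝ] ℝ} {A : E4 →L[ℝ] E4} {x : E4} {r N₁ N₂ N₃ N₄ : ℝ}, ContDiffOn ℝ ((⊤ : ℕ∞) : WithTop ℕ∞) h (ball x r) → x ∈ ball x r → x + A x ∈ ball x r → ‖A‖ ≤ 1 → (∀ z ∈ ball x r, ‖iteratedFDeriv ℝ 1 h z‖ ≤ N₁) → (∀ z ∈ ball x r, ‖iteratedFDeriv ℝ 2 h z‖ ≤ N₂) → (∀ z ∈ ball x r, ‖iteratedFDeriv ℝ 3 h z‖ ≤ N₃) → (∀ z ∈ ball x r, ‖iteratedFDeriv ℝ 4 h z‖ ≤ N₄) → ∀ v w : E4, ‖iteratedFDeriv ℝ 1 (fun y ↦ (h y + fderiv ℝ h y (A y) + (h y).comp A + (ContinuousLinearMap.precomp ℝ A).comp (h y) - (h (y + A y)).bilinearComp (ContinuousLinearMap.id ℝ E4 + A) (ContinuousLinearMap.id ℝ E4 + A)) v w) x‖ ≤ (N₃ * ‖A x‖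 ^ 2 + 3 * N₂ * ‖A‖ * ‖A x‖ + 4 * N₁ * ‖A‖ ^ 2) * ‖v‖ * ‖w‖ :=
  fun hh hx hAx hA h1 h2 h3 h4 v w ↦ norm_fderiv_dragError_apply_le hh hx hAx hA h1 h2 h3 h4 v w

end Bounds

end DragDefect

end Summit.FinalStateConjecture.FinalStateConjecture.Theorems

end
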